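import Summits.Parity.GeneralizedHardyLittlewood.Theorems.FordMaynardSieveConst01651SieveConst01651EntryLower
import Summits.Parity.GeneralizedHardyLittlewood.Theorems.FordMaynardSieveConst01651SieveConst01651CertRectsNeg
import HarnessLib

/-!
# Route `FordMaynardSieveConst01651`, target `SieveConst01651` (stmt-Parity-19185), stub `stub_certValuePos` (R2):
# a negative `g₂` entry — the outer rectangles give an upper bound

Def-free helper file (glue (Gb) of the `certP`/`certN` soundness, see `…CertAssembly`).  For a table entry
`e = (a, b, j, c)` with `c < 0`: either `a + b ≥ 72` and the region `S_e` is empty (the cell lies beyond the half line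
`y₁ + y₂ = 1/2`; no rectangles), or `a + b ≤ 70` and the outer rectangles are the `2 × 2` tiling of the half-open cell
square, which covers `S_e` (`…CertRectsNeg.certRectsNeg_eq`).  Hence `∫_{S_e} f ≤ Σ_r ∫_r f` over the outer
rectangles (`entrySq_integral_le_rects_sum`, via `…DisjointSum.setIntegral_le_sum_of_cover`), and with
`…RectSound.rectNeg_sound` and `∫_{S_e} f = σ_e ∫_{Q_e} f` the entry's contribution to `certN` is at least `D` times
minus its plane pairing (`entry_neg_sum_ge`).

References: folklore; [FordMaynard2024PrimeSieves] arXiv:2407.14368, §8.2.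
-/

noncomputable section

open MeasureTheory Set
open scoped Classical
open Literature.NumberTheory.Sieve Literature.NumberTheory.Sieve.FordMaynard
open Literature.Analysis.Convolution

namespace Summit.Parity.GeneralizedHardyLittlewood.FordMaynardSieveConst01651SieveConst01651

/-- A cell with `a + b ≥ 72` lies beyond the half line: `S_e = ∅`. [folklore] -/
theorem entrySq_eq_empty_of_ge {e : ℕ × ℕ × ℕ × ℤ} (he : e ∈ certG2) (h72 : 72 ≤ e.1 + e.2.1) :
    {y : ℝ × ℝ | ((certEdge e.1 : ℚ) : ℝ) < y.1 ∧ y.1 < ((certEdge (e.1 + 1) : ℚ) : ℝ) ∧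
      ((certEdge e.2.1 : ℚ) : ℝ) < y.2 ∧ y.2 < ((certEdge (e.2.1 + 1) : ℚ) : ℝ) ∧
      (if e.2.2.1 = 0 then y.1 + y.2 < 8349 / 20000 else 8349 / 20000 < y.1 + y.2) ∧ y.1 + y.2 < 1 / 2} = ∅ := by
  obtain ⟨hab, hb, hj⟩ := certG2_le_of_mem he
  refine Set.eq_empty_iff_forall_notMem.2 fun y hy => ?_
  simp only [Set.mem_setOf_eq] at hy
  obtain ⟨h1, -, h3, -, -, h6⟩ := hy
  rw [certEdge_cast_of_le (by omega)] at h1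
  rw [certEdge_cast_of_le (by omega)] at h3
  have hsum : (72 : ℝ) ≤ (e.1 : ℝ) + (e.2.1 : ℝ) := by exact_mod_cast h72
  nlinarith

/-- **The outer rectangles of a negative entry cover `S_e`.** [folklore] -/
theorem entrySq_subset_rects {e : ℕ × ℕ × ℕ × ℤ} (he : e ∈ certG2) (hc : e.2.2.2 < 0) :
    {y : ℝ × ℝ | ((certEdge e.1 : ℚ) : ℝ) < y.1 ∧ y.1 < ((certEdge (e.1 + 1) : ℚ) : ℝ) ∧
      ((certEdge e.2.1 : ℚ) : ℝ) < y.2 ∧ y.2 < ((certEdge (e.2.1 + 1) : ℚ) : ℝ) ∧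
      (if e.2.2.1 = 0 then y.1 + y.2 < 8349 / 20000 else 8349 / 20000 < y.1 + y.2) ∧ y.1 + y.2 < 1 / 2} ⊆
    ⋃ r ∈ entryRects e.1 e.2.1 e.2.2.1 false, (Set.Ico ((r.1 : ℝ) / tabJ) ((r.2.1 : ℝ) / tabJ) ×ˢ Set.Ico ((r.2.2.1 : ℝ) / tabJ) ((r.2.2.2 : ℝ) / tabJ)) := by
  have hJ : (tabJ : ℝ) = 120000 := by norm_num [tabJ]
  have hJpos : (0 : ℝ) < tabJ := by rw [hJ]; norm_num
  obtain ⟨hab, hb, hj⟩ := certG2_le_of_mem he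
  rcases certRectsNeg_eq he hc with ⟨h72, -⟩ | ⟨-, heq⟩
  · rw [entrySq_eq_empty_of_ge he h72]; exact Set.empty_subset _
  · rw [heq]
    intro y hy
    simp only [Set.mem_setOf_eq] at hy
    obtain ⟨h1, h2, h3, h4, -, -⟩ := hy
    have hEa_r : ((certEdge e.1 : ℚ) : ℝ) = ((19812 + e.1 * 283 : ℕ) : ℝ) / tabJ := by
      rw [certEdge_cast_of_le (by omega), hJ]; push_cast; ring
    have hEa1_r : ((certEdge (e.1 + 1) : ℚ) : ℝ) = ((19812 + e.1 * 283 + 283 : ℕ) : ℝ) / tabJ := by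
      rw [certEdge_cast_of_le (by omega), hJ]; push_cast; ring
    have hEb_r : ((certEdge e.2.1 : ℚ) : ℝ) = ((19812 + e.2.1 * 283 : ℕ) : ℝ) / tabJ := by
      rw [certEdge_cast_of_le (by omega), hJ]; push_cast; ring
    have hEb1_r : ((certEdge (e.2.1 + 1) : ℚ) : ℝ) = ((19812 + e.2.1 * 283 + 283 : ℕ) : ℝ) / tabJ := by
      rw [certEdge_cast_of_le (by omega), hJ]; push_cast; ring
    rw [hEa_r] at h1
    rw [hEa1_r] at h2
    rw [hEb_r] at h3
    rw [hEb1_r] at h4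
    refine Set.mem_iUnion₂.2 ?_
    by_cases hu : y.1 < ((19812 + e.1 * 283 + 142 : ℕ) : ℝ) / tabJ
    · by_cases hv : y.2 < ((19812 + e.2.1 * 283 + 142 : ℕ) : ℝ) / tabJ
      · exact ⟨(19812 + e.1 * 283, 19812 + e.1 * 283 + 142, 19812 + e.2.1 * 283, 19812 + e.2.1 * 283 + 142), by simp, ⟨h1.le, hu⟩, ⟨h3.le, hv⟩⟩
      · exact ⟨(19812 + e.1 * 283, 19812 + e.1 * 283 + 142, 19812 + e.2.1 * 283 + 142, 19812 + e.2.1 * 283 + 283), by simp, ⟨h1.le, hu⟩, ⟨not_lt.1 hv, h4⟩⟩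
    · by_cases hv : y.2 < ((19812 + e.2.1 * 283 + 142 : ℕ) : ℝ) / tabJ
      · exact ⟨(19812 + e.1 * 283 + 142, 19812 + e.1 * 283 + 283, 19812 + e.2.1 * 283, 19812 + e.2.1 * 283 + 142), by simp, ⟨not_lt.1 hu, h2⟩, ⟨h3.le, hv⟩⟩
      · exact ⟨(19812 + e.1 * 283 + 142, 19812 + e.1 * 283 + 283, 19812 + e.2.1 * 283 + 142, 19812 + e.2.1 * 283 + 283), by simp, ⟨not_lt.1 hu, h2⟩, ⟨not_lt.1 hv, h4⟩⟩

/-- **`∫_{S_e} f` is at most the sum of the outer rectangle integrals** (negative entry). [folklore] -/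
theorem entrySq_integral_le_rects_sum {e : ℕ × ℕ × ℕ × ℤ} (he : e ∈ certG2) (hc : e.2.2.2 < 0) :
    ∫ y in {y : ℝ × ℝ | ((certEdge e.1 : ℚ) : ℝ) < y.1 ∧ y.1 < ((certEdge (e.1 + 1) : ℚ) : ℝ) ∧
      ((certEdge e.2.1 : ℚ) : ℝ) < y.2 ∧ y.2 < ((certEdge (e.2.1 + 1) : ℚ) : ℝ) ∧
      (if e.2.2.1 = 0 then y.1 + y.2 < 8349 / 20000 else 8349 / 20000 < y.1 + y.2) ∧ y.1 + y.2 < 1 / 2},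
          (if 0 ≤ y.1 + y.2 ∧ y.1 + y.2 ≤ 1 then ∑ k ∈ Finset.Icc 1 6, (1 / (k.factorial : ℝ)) *
            cpow (fun t : ℝ => if (1651 / 10000 : ℝ) < t then 1 / t else 0) k (1 - (y.1 + y.2)) else 0) /
            (y.1 * y.2) ∂((volume : Measure ℝ).prod volume) ≤
    ((entryRects e.1 e.2.1 e.2.2.1 false).map fun r : ℕ × ℕ × ℕ × ℕ =>
      ∫ y in (Set.Ico ((r.1 : ℝ) / tabJ) ((r.2.1 : ℝ) / tabJ) ×ˢ Set.Ico ((r.2.2.1 : ℝ) / tabJ) ((r.2.2.2 : ℝ) / tabJ)),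
          (if 0 ≤ y.1 + y.2 ∧ y.1 + y.2 ≤ 1 then ∑ k ∈ Finset.Icc 1 6, (1 / (k.factorial : ℝ)) *
            cpow (fun t : ℝ => if (1651 / 10000 : ℝ) < t then 1 / t else 0) k (1 - (y.1 + y.2)) else 0) /
            (y.1 * y.2) ∂((volume : Measure ℝ).prod volume)).sum := by
  have hJpos : (0 : ℝ) < tabJ := by norm_num [tabJ]
  obtain ⟨hΨm, C, hΨC⟩ := truncPhi_measurable_bdd
  have hdec : decide (0 < e.2.2.2) = false := decide_eq_false (by omega)
  have hspec : ∀ r ∈ entryRects e.1 e.2.1 e.2.2.1 false, 0 < r.1 ∧ 0 < r.2.2.1 := by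
    intro r hr
    have hr' : r ∈ entryRects e.1 e.2.1 e.2.2.1 (decide (0 < e.2.2.2)) := by rw [hdec]; exact hr
    obtain ⟨h0u, -, h0v, -⟩ := certRects_spec he hr'
    exact ⟨h0u, h0v⟩
  refine setIntegral_le_sum_of_cover
    (fun r : ℕ × ℕ × ℕ × ℕ => (Set.Ico ((r.1 : ℝ) / tabJ) ((r.2.1 : ℝ) / tabJ) ×ˢ Set.Ico ((r.2.2.1 : ℝ) / tabJ) ((r.2.2.2 : ℝ) / tabJ)))
    (fun r => measurableSet_Ico.prod measurableSet_Ico) _ (fun r hr => ?_) (fun r hr y hy => ?_) ?_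
    (entrySq_subset_rects he hc)
  · obtain ⟨h0u, h0v⟩ := hspec r hr
    have ha : (0 : ℝ) < ((r.1 : ℕ) : ℝ) / tabJ := by positivity
    have hc' : (0 : ℝ) < ((r.2.2.1 : ℕ) : ℝ) / tabJ := by positivity
    exact integrableOn_rect_Ico hΨm hΨC ha hc'
  · obtain ⟨h0u, h0v⟩ := hspec r hr
    have ha : (0 : ℝ) < ((r.1 : ℕ) : ℝ) / tabJ := by positivity
    have hc' : (0 : ℝ) < ((r.2.2.1 : ℕ) : ℝ) / tabJ := by positivity
    exact truncWeight_nonneg y (lt_of_lt_of_le ha hy.1.1) (lt_of_lt_of_le hc' hy.2.1)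
  · exact (certRects_disjoint he false).imp fun {r s} h => rect_disjoint_of_sep h

/-- **A negative entry's contribution to `certN` is at least `D` times minus its plane pairing.** [folklore] -/
theorem entry_neg_sum_ge {e : ℕ × ℕ × ℕ × ℤ} (he : e ∈ certG2) (hc : e.2.2.2 < 0) :
    (tabD : ℝ) * -(∫ y : ℝ × ℝ, (if ((certEdge e.1 : ℚ) : ℝ) < y.1 ∧ y.1 < ((certEdge (e.1 + 1) : ℚ) : ℝ) ∧
            ((certEdge e.2.1 : ℚ) : ℝ) < y.2 ∧ y.2 < ((certEdge (e.2.1 + 1) : ℚ) : ℝ) ∧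
            y.1 ≤ y.2 ∧ (if e.2.2.1 = 0 then y.1 + y.2 < 8349 / 20000 else 8349 / 20000 < y.1 + y.2) ∧
            y.1 + y.2 < 1 / 2
        then (((e.2.2.2 : ℤ) : ℝ) / 1000000) * (∑ m ∈ Finset.Icc 1 6, (1 / (m.factorial : ℝ)) *
          cpow (fun t : ℝ => if (1651 / 10000 : ℝ) < t then 1 / t else 0) m (1 - (y.1 + y.2))) / (y.1 * y.2)
        else 0) ∂((volume : Measure ℝ).prod volume)) ≤
    ((((entryRects e.1 e.2.1 e.2.2.1 false).map
        (rectNeg certBlockHi e.2.2.2.natAbs (if e.1 == e.2.1 then 2 else 1))).sum : ℕ) : ℝ) := by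
  have hD : (0 : ℝ) < tabD := by norm_num [tabD]
  set σ : ℕ := (if e.1 == e.2.1 then 2 else 1) with hσdef
  have hσ : 0 < σ := by rw [hσdef]; split_ifs <;> norm_num
  have hσr : (0 : ℝ) < (σ : ℝ) := by exact_mod_cast hσ
  have hc' : ((e.2.2.2.natAbs : ℕ) : ℝ) = -((e.2.2.2 : ℤ) : ℝ) := by
    have h : ((e.2.2.2.natAbs : ℕ) : ℤ) = -e.2.2.2 := by
      rw [← Int.natAbs_neg]; exact Int.natAbs_of_nonneg (by omega)
    rw [← Int.cast_neg]
    conv_rhs => rw [← h]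
    simp only [Int.cast_natCast]
  have hdec : decide (0 < e.2.2.2) = false := decide_eq_false (by omega)
  -- per rectangle: `D · (|c|/10⁶/σ) · ∫_rect f ≤ rectNeg`
  have hper : ∀ r ∈ entryRects e.1 e.2.1 e.2.2.1 false,
      ((e.2.2.2.natAbs : ℕ) : ℝ) / 1000000 / σ *
          (∫ y in (Set.Ico ((r.1 : ℝ) / tabJ) ((r.2.1 : ℝ) / tabJ) ×ˢ Set.Ico ((r.2.2.1 : ℝ) / tabJ) ((r.2.2.2 : ℝ) / tabJ)),
          (if 0 ≤ y.1 + y.2 ∧ y.1 + y.2 ≤ 1 then ∑ k ∈ Finset.Icc 1 6, (1 / (k.factorial : ℝ)) *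
            cpow (fun t : ℝ => if (1651 / 10000 : ℝ) < t then 1 / t else 0) k (1 - (y.1 + y.2)) else 0) /
            (y.1 * y.2) ∂((volume : Measure ℝ).prod volume)) * tabD ≤
        ((rectNeg certBlockHi e.2.2.2.natAbs σ r : ℕ) : ℝ) := by
    intro r hr
    have hr' : r ∈ entryRects e.1 e.2.1 e.2.2.1 (decide (0 < e.2.2.2)) := by rw [hdec]; exact hr
    obtain ⟨h0u, hu, h0v, hv, hhi, hlo, -⟩ := certRects_spec he hr'
    obtain ⟨u0, u1, v0, v1⟩ := r
    exact (le_div_iff₀ hD).1 (rectNeg_sound h0u hu.le h0v hv.le hhi hlo e.2.2.2.natAbs σ hσ)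
  have hsum := List.sum_le_sum hper
  have hcov := entrySq_integral_le_rects_sum he hc
  rw [setIntegral_entrySq_eq he] at hcov
  have hcn : (0 : ℝ) ≤ ((e.2.2.2.natAbs : ℕ) : ℝ) / 1000000 / σ := by positivity
  calc (tabD : ℝ) * -(∫ y : ℝ × ℝ, (if ((certEdge e.1 : ℚ) : ℝ) < y.1 ∧ y.1 < ((certEdge (e.1 + 1) : ℚ) : ℝ) ∧
            ((certEdge e.2.1 : ℚ) : ℝ) < y.2 ∧ y.2 < ((certEdge (e.2.1 + 1) : ℚ) : ℝ) ∧
            y.1 ≤ y.2 ∧ (if e.2.2.1 = 0 then y.1 + y.2 < 8349 / 20000 else 8349 / 20000 < y.1 + y.2) ∧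
            y.1 + y.2 < 1 / 2
        then (((e.2.2.2 : ℤ) : ℝ) / 1000000) * (∑ m ∈ Finset.Icc 1 6, (1 / (m.factorial : ℝ)) *
          cpow (fun t : ℝ => if (1651 / 10000 : ℝ) < t then 1 / t else 0) m (1 - (y.1 + y.2))) / (y.1 * y.2)
        else 0) ∂((volume : Measure ℝ).prod volume))
      = ((e.2.2.2.natAbs : ℕ) : ℝ) / 1000000 / σ * ((σ : ℝ) * ∫ y in {y : ℝ × ℝ | ((certEdge e.1 : ℚ) : ℝ) < y.1 ∧ y.1 < ((certEdge (e.1 + 1) : ℚ) : ℝ) ∧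
      ((certEdge e.2.1 : ℚ) : ℝ) < y.2 ∧ y.2 < ((certEdge (e.2.1 + 1) : ℚ) : ℝ) ∧
      y.1 ≤ y.2 ∧ (if e.2.2.1 = 0 then y.1 + y.2 < 8349 / 20000 else 8349 / 20000 < y.1 + y.2) ∧
      y.1 + y.2 < 1 / 2},
          (if 0 ≤ y.1 + y.2 ∧ y.1 + y.2 ≤ 1 then ∑ k ∈ Finset.Icc 1 6, (1 / (k.factorial : ℝ)) *
            cpow (fun t : ℝ => if (1651 / 10000 : ℝ) < t then 1 / t else 0) k (1 - (y.1 + y.2)) else 0) /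
            (y.1 * y.2) ∂((volume : Measure ℝ).prod volume)) * tabD := by
        rw [plane_eq_mul_setIntegral, hc', ← mul_assoc (-((e.2.2.2 : ℤ) : ℝ) / 1000000 / σ),
          div_mul_cancel₀ _ hσr.ne']
        ring
    _ ≤ ((e.2.2.2.natAbs : ℕ) : ℝ) / 1000000 / σ * ((entryRects e.1 e.2.1 e.2.2.1 false).map fun r : ℕ × ℕ × ℕ × ℕ =>
        ∫ y in (Set.Ico ((r.1 : ℝ) / tabJ) ((r.2.1 : ℝ) / tabJ) ×ˢ Set.Ico ((r.2.2.1 : ℝ) / tabJ) ((r.2.2.2 : ℝ) / tabJ)),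
          (if 0 ≤ y.1 + y.2 ∧ y.1 + y.2 ≤ 1 then ∑ k ∈ Finset.Icc 1 6, (1 / (k.factorial : ℝ)) *
            cpow (fun t : ℝ => if (1651 / 10000 : ℝ) < t then 1 / t else 0) k (1 - (y.1 + y.2)) else 0) /
            (y.1 * y.2) ∂((volume : Measure ℝ).prod volume)).sum * tabD := by
        gcongr
    _ = ((entryRects e.1 e.2.1 e.2.2.1 false).map fun r : ℕ × ℕ × ℕ × ℕ =>
        ((e.2.2.2.natAbs : ℕ) : ℝ) / 1000000 / σ *
          (∫ y in (Set.Ico ((r.1 : ℝ) / tabJ) ((r.2.1 : ℝ) / tabJ) ×ˢ Set.Ico ((r.2.2.1 : ℝ) / tabJ) ((r.2.2.2 : ℝ) / tabJ)),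
          (if 0 ≤ y.1 + y.2 ∧ y.1 + y.2 ≤ 1 then ∑ k ∈ Finset.Icc 1 6, (1 / (k.factorial : ℝ)) *
            cpow (fun t : ℝ => if (1651 / 10000 : ℝ) < t then 1 / t else 0) k (1 - (y.1 + y.2)) else 0) /
            (y.1 * y.2) ∂((volume : Measure ℝ).prod volume)) * tabD).sum := by
        rw [List.sum_map_mul_right, List.sum_map_mul_left]
    _ ≤ ((entryRects e.1 e.2.1 e.2.2.1 false).map fun r : ℕ × ℕ × ℕ × ℕ =>
        ((rectNeg certBlockHi e.2.2.2.natAbs σ r : ℕ) : ℝ)).sum := hsum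
    _ = ((((entryRects e.1 e.2.1 e.2.2.1 false).map (rectNeg certBlockHi e.2.2.2.natAbs σ)).sum : ℕ) : ℝ) := by
        rw [Nat.cast_list_sum, List.map_map]
        rfl

end Summit.Parity.GeneralizedHardyLittlewood.FordMaynardSieveConst01651SieveConst01651

end
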